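import Summits.CriticalPhenomena.PercolationContinuityZ3.Theorems.SoloBlindSlitChains
import Summits.CriticalPhenomena.PercolationContinuityZ3.Theorems.SoloBlindPeriodicFin
import HarnessLib

/-!
# A plane wall with a periodic line of pores, II: the chain bound and the contraction criterion

The kernel iteration of `SoloBlindPeriodicFin` (reused: `kerW`, `kerR`, `kerSup`, `kerTot`, `Pc`, `admInd`)
run on the slit regions `R_Z = ℍ ∪ L_Z` of `SoloBlindSlitChains`: with the one-step kernel
`kerL s z z' = 1[adm] · P(cpt s z ↔ cpt s z' via K₀) · P(connector z' open)` and start weights `startL`,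
`P(x ↔ ∞ in R_Z) ≤ Γ · (κ̄_ℍ κ̄_L)^m` for every `m` (`measure_percolatesVia_KL_le_pow`), hence
`Γ < ∞ ∧ κ̄_ℍ κ̄_L < 1 ⟹ P(x ↔ ∞ in R_Z) = 0` (`measure_percolatesVia_KL_eq_zero`).
-/

noncomputable section

namespace Summit.CriticalPhenomena.PercolationContinuityZ3.Theorems

open MeasureTheory Filter Topology Literature.Probability.Percolation Literature.Probability.LatticeModels
open scoped ENNReal

section Weights

variable (Z : Set ℤ)

/-- The one-step kernel: admissibility × `P(cpt s z ↔ cpt s z' via K₀)` × `P(connector z' open)`. -/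
def kerL (s : Bool) (z z' : ℤ) : ℝ≥0∞ :=
  admInd Z z z' * (Pc (openConnVia (KL0 Z) (cpt s z) (cpt s z')) *
    Pc {ω | s(cpt s z', cpt (!s) z') ∈ ω})

/-- The start weight from `x`: `1[z ∈ Z] × P(x ↔ cpt s z via K₀) × P(connector z open)`. -/
def startL (x : Site 3) (s : Bool) (z : ℤ) : ℝ≥0∞ :=
  Set.indicator Z (fun _ => 1) z * (Pc (openConnVia (KL0 Z) x (cpt s z)) *
    Pc {ω | s(cpt s z, cpt (!s) z) ∈ ω})

/-- The product of the chain-event probabilities. -/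
def chainWL : Site 3 → (n : ℕ) → Bool → (Fin n → ℤ) → ℝ≥0∞
  | _, 0, _, _ => 1
  | a, n + 1, s, f => Pc (openConnVia (KL0 Z) a (cpt s (f 0))) *
      Pc {ω | s(cpt s (f 0), cpt (!s) (f 0)) ∈ ω} * chainWL (cpt (!s) (f 0)) n (!s) (Fin.tail f)

/-- The chain weight is the product of the probabilities of the chain events. -/
theorem chainWL_eq_prod : ∀ (n : ℕ) (a : Site 3) (s : Bool) (f : Fin n → ℤ),
    chainWL Z a n s f = ((chainEvents (KL0 Z) a (mkChain n s f)).map Pc).prod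
  | 0, _, _, _ => by simp [chainWL]
  | n + 1, a, s, f => by
    rw [chainWL, mkChain_succ, chainEvents_cons, List.map_cons, List.map_cons, List.prod_cons,
      List.prod_cons, chainWL_eq_prod n, crossE_fst, crossE_snd, mul_assoc]

variable {Z}

/-- On admissible sequences the kernel weight is the chain weight. -/
theorem kerW_eq_chainWL : ∀ (n : ℕ) (s : Bool) {z : ℤ} (f : Fin n → ℤ), z ∈ Z → f ∈ admSet Z n z →
    kerW (kerL Z) n s z f = chainWL Z (cpt s z) n s f
  | 0, _, _, _, _, _ => rfl
  | n + 1, s, z, f, hz, hf => by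
    obtain ⟨h0, hne, htail⟩ := (mem_admSet_succ Z n z f).1 hf
    rw [kerW, chainWL, kerL, admInd_of_mem hz h0 hne, one_mul, kerW_eq_chainWL n (!s) _ h0 htail,
      mul_assoc]

/-- Start weight times kernel weight is the chain weight, on start-admissible sequences. -/
theorem start_mul_kerW_eq_chainWL (n : ℕ) (x : Site 3) (s : Bool) (f : Fin (n + 1) → ℤ)
    (hf : f ∈ admSet₀ Z (n + 1)) :
    startL Z x s (f 0) * kerW (kerL Z) n (!s) (f 0) (Fin.tail f) = chainWL Z x (n + 1) s f := by
  obtain ⟨h0, htail⟩ := (mem_admSet₀_succ Z n f).1 hf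
  rw [startL, Set.indicator_of_mem h0, one_mul, kerW_eq_chainWL n (!s) _ h0 htail, chainWL, mul_assoc]

/-- **The chain bound.** For `x` on side `s`, for every `n`,
`P(x ↔ ∞ in R_Z) ≤ Σ_f startL(f₀) · kerW(f)` over height sequences of length `n + 1`. -/
theorem measure_percolatesVia_KL_le_tsum (x : Site 3) (s : Bool) (hx : x ∈ sideL Z s) (n : ℕ) :
    Pc (percolatesVia (KL Z) x) ≤
      ∑' f : Fin (n + 1) → ℤ, startL Z x s (f 0) * kerW (kerL Z) n (!s) (f 0) (Fin.tail f) := by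
  classical
  let E : (Fin (n + 1) → ℤ) → Set (BondConfig (Site 3)) := fun f =>
    {ω | f ∈ admSet₀ Z (n + 1) ∧ ω ∈ disjointOccurrenceList (chainEvents (KL0 Z) x (mkChain (n + 1) s f))}
  calc Pc (percolatesVia (KL Z) x) ≤ Pc (⋃ f, E f) := by
        refine measure_mono_ae ?_
        filter_upwards [ae_forall_pieceL_finite Z] with ω hfin hperc
        obtain ⟨f, hf, hD⟩ := exists_adm_mem_disjointOccurrenceList_slit s hx hfin hperc (n + 1)
        exact Set.mem_iUnion.2 ⟨f, hf, hD⟩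
    _ ≤ ∑' f, Pc (E f) := measure_iUnion_le E
    _ ≤ _ := ENNReal.tsum_le_tsum fun f => ?_
  by_cases hf : f ∈ admSet₀ Z (n + 1)
  · rw [start_mul_kerW_eq_chainWL n x s f hf, chainWL_eq_prod]
    refine (measure_mono ?_).trans (measure_disjointOccurrenceList_chainEvents_le _ _ _ _ _)
    exact fun ω hω => hω.2
  · have : E f = ∅ := Set.eq_empty_of_forall_notMem fun ω hω => hf hω.1
    rw [this, measure_empty]; exact zero_le

/-- **Geometric decay in the chain length**: with `Γ = Σ_z startL` and
`ρ = kerTot(true) · kerTot(false)`, `P(x ↔ ∞ in R_Z) ≤ Γ ρ^m` for every `m`. -/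
theorem measure_percolatesVia_KL_le_pow (x : Site 3) (s : Bool) (hx : x ∈ sideL Z s) (m : ℕ) :
    Pc (percolatesVia (KL Z) x) ≤
      (∑' z, startL Z x s z) * (kerTot (kerL Z) true * kerTot (kerL Z) false) ^ m := by
  refine (measure_percolatesVia_KL_le_tsum x s hx (2 * m)).trans ?_
  refine (tsum_start_le (kerL Z) (startL Z x s) (2 * m) (!s)).trans ?_
  refine mul_le_mul' le_rfl ((kerSup_two_mul_le (kerL Z) (!s) m).trans_eq ?_)
  cases s
  · rfl
  · simp [mul_comm]

/-- **Contraction criterion.** If `Σ_z startL < ∞` and `kerTot(true) · kerTot(false) < 1` then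
`P(x ↔ ∞ in R_Z) = 0`. -/
theorem measure_percolatesVia_KL_eq_zero (x : Site 3) (s : Bool) (hx : x ∈ sideL Z s)
    (hΓ : ∑' z, startL Z x s z ≠ ⊤) (hρ : kerTot (kerL Z) true * kerTot (kerL Z) false < 1) :
    Pc (percolatesVia (KL Z) x) = 0 := by
  have ht := ENNReal.Tendsto.const_mul (ENNReal.tendsto_pow_atTop_nhds_zero_of_lt_one hρ)
    (Or.inr hΓ) (a := ∑' z, startL Z x s z)
  rw [mul_zero] at ht
  exact le_antisymm (ge_of_tendsto' ht fun m => measure_percolatesVia_KL_le_pow x s hx m) zero_le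

end Weights

end Summit.CriticalPhenomena.PercolationContinuityZ3.Theorems

end
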